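import Literature.Barriers.AnomalousDissipation.ShearFlowViscositySelectionSteps
import Literature.Analysis.FluidPDE.NSHopfShearClass
import Literature.Analysis.FluidPDE.NSUniqueness2HalfD
import HarnessLib

/-!
# Bardos–Titi–Wiedemann 2012, Thm. 5 — discharge of the structural fact
`BardosTitiWiedemann2012_thm5_shearLerayHopf` (a Leray–Hopf solution of the shear ansatz form)
and of part (ii), the uniqueness fact `BardosTitiWiedemann2012_thm5_uniqueness`

Companion to `Literature/Barriers/AnomalousDissipation/ShearFlowViscositySelectionSteps.lean`,
which vendors, as the named fact `BardosTitiWiedemann2012_thm5_shearLerayHopf`, the structural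
claim of the printed proof of Bardos–Titi–Wiedemann, C. R. Math. 350 (2012), Thm. 5: for shear
data `v₀ = (v₁(x₂), 0, v₃(x₁,x₂))`, `v₁ ∈ L²(T)`, `v₃ ∈ L²(T²)`, `T > 0`, `ν > 0`, there is a
Leray–Hopf weak solution of the unforced Navier–Stokes equations on `T³ × [0,T)` with datum `v₀`
*of the ansatz form* `u^ν(x,t) = (u₁^ν(x₂,t), 0, u₃^ν(x₁,x₂,t))` ("The intuition that the
solution of Navier-Stokes should preserve the particular structure of the initial data leads us
to the ansatz … Hence, for every fixed `ν > 0`, we obtain a Leray-Hopf weak solution with the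
initial data `v₀(x)`", op. cit., proof of Thm. 5).

## This file (all proved)

* `mFourierCoeff_shearData_shear` — the Fourier coefficients of the shear datum lie in the shear
  class of `Literature/Analysis/FluidPDE/NSHopfShearClass`: no modes with `k₂ ≠ 0` (the datum does
  not depend on `x₃`), vanishing second component, and a first component without modes `k₀ ≠ 0`
  (`v₁(x₂)` does not depend on `x₁`) — `Torus.mFourierCoeff_eq_zero_of_forall_add_single` and
  `Torus.mFourierCoeff_apply_euclidean`, as in `isWeaklyDivFree_shearData`.
* `BardosTitiWiedemann2012_thm5_shearLerayHopf_global` — the global form: for every `ν > 0` there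
  are `a`, `c` with `(t,x) ↦ (a t (x 1), 0, c t (x 0, x 1))` a *global* Leray–Hopf weak solution
  with datum `shearData v₁ v₃` (Hopf's Galerkin construction run in the closed shear class,
  `Literature.Analysis.FluidPDE.exists_isGlobalLerayHopf_shear`; the printed proof solves the
  heat and advection–diffusion equations of the "two-and-half Navier–Stokes" system instead —
  the same solution, by the uniqueness part of Thm. 5).
* `BardosTitiWiedemann2012_thm5_shearLerayHopf_holds` — **discharge** of the named fact.
* `BardosTitiWiedemann2012_thm5_uniqueness_holds` — **discharge of part (ii)** of Thm. 5 (the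
  named fact `BardosTitiWiedemann2012_thm5_uniqueness` of the Steps file: any two Leray–Hopf weak
  solutions with shear datum agree a.e. on every slice `t ∈ (0,T]`; op. cit., proof of Thm. 5:
  "Following ideas from [Serrin] (see, e.g., [BLNNT] and [Iftimie-Raugel] for details) one can
  show that this solution is unique within the class of all 3D Leray-Hopf weak solutions"). The
  indicated argument is the weak–strong uniqueness theorem *off* the Prodi–Serrin scale of
  Bardos–Lopes Filho–Niu–Nussenzveig Lopes–Titi 2013, Thm. 3.1 / Rem. 3.1, proved on `T³` in
  `Literature/Analysis/FluidPDE/NSUniqueness2HalfD.lean` (`Torus.lerayHopf_ae_eq_of_invariant_datum`):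
  Hopf's theorem in the closed `x₃`-invariant class (`hopf_existence_torus_invariant_holds`)
  supplies an `x₃`-independent reference Leray–Hopf solution for the `x₃`-independent shear
  datum; Serrin's cross-testing of the two weak formulations at the level of Fourier truncations
  (`FluidPDE/LerayHopfCrossIdentityTorus`), the sliced (anisotropic) Ladyzhenskaya estimate of
  the trilinear term (`FunctionSpaces/TorusAnisotropicLadyzhenskaya`), the limit `N → ∞`
  (`FluidPDE/NSUniqueness2HalfDEstimates`), Young's inequality and the integral Grönwall lemma
  give `u = U` for every Leray–Hopf `u`. The shear datum is admissible by `memLp_shearData`,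
  `isWeaklyDivFree_shearData`, `shearData_add_single_two`.

## References

* C. Bardos, E. S. Titi, E. Wiedemann, C. R. Math. Acad. Sci. Paris 350 (2012) 757–760, Thm. 5
  and its proof (`BardosTitiWiedemann2012`).
* E. Hopf, Math. Nachr. 4 (1951) 213–231, §§2–4 (`Hopf1951`); J. C. Robinson, J. L. Rodrigo,
  W. Sadowski, *The three-dimensional Navier–Stokes equations* (2016), Thm. 4.4.
* R. J. DiPerna, A. J. Majda, Comm. Math. Phys. 108 (1987) 667–689 (`DiPernaMajda1987`).
* C. Bardos, M. C. Lopes Filho, D. Niu, H. J. Nussenzveig Lopes, E. S. Titi, SIAM J. Math. Anal.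
  45 (2013) 1871–1885, Thm. 3.1, Rem. 3.1 (`BardosEtAl2013`).
* J. Serrin, in *Nonlinear Problems* (Madison 1962), 1963, §4, Thm. 6 (`Serrin1963`).
-/

open MeasureTheory Set Filter Topology UnitAddTorus
open scoped ENNReal NNReal

noncomputable section

namespace Literature.Barriers.AnomalousDissipation

variable {v₁ : UnitAddCircle → ℝ} {v₃ : UnitAddTorus (Fin 2) → ℝ}

/-- **The shear datum has Fourier coefficients in the shear class.** For `v₁ ∈ L²(T)`,
`v₃ ∈ L²(T²)` and `v₀ = (v₁(x₂), 0, v₃(x₁,x₂))`: `v̂₀(k) = 0` whenever `k₂ ≠ 0` (the datum is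
invariant under translations along the third axis, `Torus.mFourierCoeff_eq_zero_of_forall_add_single`),
`v̂₀(k)₁ = 0` (the second component vanishes), and `v̂₀(k)₀ = 0` whenever `k₀ ≠ 0` (the first
component `v₁(x₂)` is invariant under translations along the first axis); componentwise by
`Torus.mFourierCoeff_apply_euclidean`. [folklore] -/
theorem mFourierCoeff_shearData_shear (hv₁ : MemLp v₁ 2 volume) (hv₃ : MemLp v₃ 2 volume) :
    (∀ k : Fin 3 → ℤ, k 2 ≠ 0 →
      mFourierCoeff (Literature.Analysis.FunctionSpaces.EuclideanSpace.complexify ∘ shearData v₁ v₃) k = 0) ∧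
    (∀ k : Fin 3 → ℤ,
      mFourierCoeff (Literature.Analysis.FunctionSpaces.EuclideanSpace.complexify ∘ shearData v₁ v₃) k 1 = 0) ∧
    ∀ k : Fin 3 → ℤ, k 0 ≠ 0 →
      mFourierCoeff (Literature.Analysis.FunctionSpaces.EuclideanSpace.complexify ∘ shearData v₁ v₃) k 0 = 0 := by
  have hmem := memLp_shearData hv₁ hv₃
  have hint : Integrable
      (Literature.Analysis.FunctionSpaces.EuclideanSpace.complexify ∘ shearData v₁ v₃) volume :=
    Literature.Analysis.FunctionSpaces.Torus.integrable_complexify_comp (hmem.integrable one_le_two)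
  have hc0 : (fun x : UnitAddTorus (Fin 3) =>
      (Literature.Analysis.FunctionSpaces.EuclideanSpace.complexify ∘ shearData v₁ v₃) x 0) =
      fun x => ((v₁ (x 1) : ℝ) : ℂ) := by
    funext x; simp [shearData]
  have hc1 : (fun x : UnitAddTorus (Fin 3) =>
      (Literature.Analysis.FunctionSpaces.EuclideanSpace.complexify ∘ shearData v₁ v₃) x 1) =
      fun _ => (0 : ℂ) := by
    funext x; simp [shearData]
  refine ⟨fun k hk => ?_, fun k => ?_, fun k hk => ?_⟩
  · exact Literature.Analysis.FunctionSpaces.Torus.mFourierCoeff_eq_zero_of_forall_add_single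
      (f := Literature.Analysis.FunctionSpaces.EuclideanSpace.complexify ∘ shearData v₁ v₃) (i := 2)
      (fun s x => by simp only [Function.comp_apply, shearData_add_single_two]) hk
  · rw [Literature.Analysis.FunctionSpaces.Torus.mFourierCoeff_apply_euclidean hint k 1, hc1,
      Literature.Analysis.FluidPDE.Torus.mFourierCoeff_fun_zero]
  · rw [Literature.Analysis.FunctionSpaces.Torus.mFourierCoeff_apply_euclidean hint k 0, hc0]
    exact Literature.Analysis.FunctionSpaces.Torus.mFourierCoeff_eq_zero_of_forall_add_single
      (i := 0) (fun s x => by simp) hk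

/-- **A global Leray–Hopf solution of the shear ansatz form** (Bardos–Titi–Wiedemann 2012,
proof of Thm. 5, global-in-time form). For shear data `v₀ = (v₁(x₂), 0, v₃(x₁,x₂))`,
`v₁ ∈ L²(T)`, `v₃ ∈ L²(T²)`, and `ν > 0`, there are `a : ℝ → T → ℝ`, `c : ℝ → T² → ℝ` such that
`u^ν(x,t) = (a t (x₂), 0, c t (x₁,x₂))` is a global Leray–Hopf weak solution of the unforced
Navier–Stokes equations on `T³` with viscosity `ν` and datum `v₀` (Leray–Hopf on `[0,T)` for
every `T > 0`). Obtained by Hopf's Galerkin construction run in the closed shear class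
(`Literature.Analysis.FluidPDE.exists_isGlobalLerayHopf_shear`), the datum being admissible by
`memLp_shearData`, `isWeaklyDivFree_shearData`, `mFourierCoeff_shearData_shear`. [cite: BardosTitiWiedemann2012, Thm. 5, proof] -/
theorem BardosTitiWiedemann2012_thm5_shearLerayHopf_global (v₁ : UnitAddCircle → ℝ)
    (hv₁ : MemLp v₁ 2 volume) (v₃ : UnitAddTorus (Fin 2) → ℝ) (hv₃ : MemLp v₃ 2 volume) {ν : ℝ}
    (hν : 0 < ν) :
    ∃ (a : ℝ → UnitAddCircle → ℝ) (c : ℝ → UnitAddTorus (Fin 2) → ℝ),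
      Literature.Analysis.FluidPDE.Torus.IsGlobalLerayHopf ν 0 (shearData v₁ v₃)
        fun t x => !₂[a t (x 1), 0, c t ![x 0, x 1]] := by
  obtain ⟨h2, h1, h0⟩ := mFourierCoeff_shearData_shear hv₁ hv₃
  exact Literature.Analysis.FluidPDE.exists_isGlobalLerayHopf_shear ν hν (shearData v₁ v₃)
    (memLp_shearData hv₁ hv₃) (isWeaklyDivFree_shearData hv₁ hv₃) h2 h1 h0

/-- **Discharge of `BardosTitiWiedemann2012_thm5_shearLerayHopf`** (Bardos–Titi–Wiedemann 2012,
proof of Thm. 5: "for every fixed `ν > 0`, we obtain a Leray-Hopf weak solution with the initial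
data `v₀(x)`" of the ansatz form `(u₁^ν(x₂,t), 0, u₃^ν(x₁,x₂,t))`): restriction of the global
solution of `BardosTitiWiedemann2012_thm5_shearLerayHopf_global` to `[0, T)`. [cite: BardosTitiWiedemann2012, Thm. 5, proof] -/
theorem BardosTitiWiedemann2012_thm5_shearLerayHopf_holds :
    BardosTitiWiedemann2012_thm5_shearLerayHopf := by
  intro v₁ hv₁ v₃ hv₃ T hT ν hν
  obtain ⟨a, c, h⟩ := BardosTitiWiedemann2012_thm5_shearLerayHopf_global v₁ hv₁ v₃ hv₃ hν
  exact ⟨a, c, h T hT⟩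

/-- **Bardos–Titi–Wiedemann 2012, Thm. 5, part (ii), proved.** The named fact
`BardosTitiWiedemann2012_thm5_uniqueness` holds: for shear data `v₀ = (v₁(x₂), 0, v₃(x₁,x₂))`
with `v₁ ∈ L²(T)`, `v₃ ∈ L²(T²)`, `T > 0` and `ν > 0`, any two Leray–Hopf weak solutions of the
unforced Navier–Stokes equations on `T³ × [0,T)` with datum `v₀` agree almost everywhere on every
slice `t ∈ (0, T]`. Real proof: the datum is square integrable, weakly divergence free and
invariant under the vertical translations (`memLp_shearData`, `isWeaklyDivFree_shearData`,
`shearData_add_single_two`), so the uniqueness theorem for `x₃`-independent data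
`Literature.Analysis.FluidPDE.Torus.lerayHopf_ae_eq_of_invariant_datum` (Bardos–Lopes Filho–Niu–
Nussenzveig Lopes–Titi 2013, Thm. 3.1 / Rem. 3.1, proved in the tree on `T³`) applies. [cite: BardosTitiWiedemann2012, Thm. 5] [cite: BardosEtAl2013, Thm. 3.1 and Rem. 3.1] -/
theorem BardosTitiWiedemann2012_thm5_uniqueness_holds : BardosTitiWiedemann2012_thm5_uniqueness := by
  intro v₁ hv₁ v₃ hv₃ T hT ν hν u u' hu hu' t ht
  exact Literature.Analysis.FluidPDE.Torus.lerayHopf_ae_eq_of_invariant_datum hν hT (memLp_shearData hv₁ hv₃)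
    (isWeaklyDivFree_shearData hv₁ hv₃) (fun s x => shearData_add_single_two v₁ v₃ s x) hu hu' t ht

end Literature.Barriers.AnomalousDissipation

end
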